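import Summits.CriticalPhenomena.PercolationContinuityZ3.Theorems.SahiBoxTP2BooleanSpinsCountable

/-!
# Random subsets of a countable set (`Measure (Set ι)`): FKG-lattice cylinder probabilities ⇒ Sahi positivity given `C_n`

Support file of the Sahi cell (`prim-sahi`, typer seat, generation 12; `--supports stmt-CriticalPhenomena-4575`).

The cell's percolation-type laws (`prodBernoulli`, `bondPercolation`, `rcMeasure`, …) are measures on a type of SETS
(`Set ι`, open edges / occupied sites).  This file transports the `{0,1}^ι` theorems of
`SahiBoxTP2BooleanSpinsCountable.lean` along the measurable order isomorphism `Set ι ≃o (ι → Bool)`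
(`setBoolIso`, indicator / support):

* `isBoxTP2_iff_map_setBoolIso` — box-TP₂ for a law on `Set ι` (boxes `{x | s ⊆ x ⊆ t}`) ⟺ box-TP₂ of its image on
  `{0,1}^ι`; `isBoxTP2_of_fkg_setCylinders`: **FKG-lattice cylinder probabilities
  `μ{x | x ∩ J = A ∩ J}·μ{x ∩ J = B ∩ J} ≤ μ{x ∩ J = (A ∩ B) ∩ J}·μ{x ∩ J = (A ∪ B) ∩ J}` (all finite `J`) ⇒ box-TP₂**.
* `msahiE_nonneg_of_isBoxTP2_set` (+ `_antitone`), `msahiE_nonneg_of_fkg_setCylinders(_of_sahiConjecture)`: **given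
  `C_n`, `E_n(f_0,…,f_{n−1}) ≥ 0` for all measurable nonnegative monotone (for `⊆`) functionals `f_i : Set ι → ℝ`**;
  UNCONDITIONALLY `integral_mul_integral_le_of_fkg_setCylinders` (the FKG inequality for random subsets of a countable
  set with FKG-lattice cylinder probabilities — e.g. weak limits of finite-volume random-cluster measures).

No sorries, no new axioms.
-/

noncomputable section

namespace Summit.CriticalPhenomena.PercolationContinuityZ3.Theorems.SahiBoxTP2

open MeasureTheory ProbabilityTheory Set Filter Topology Function Literature.Combinatorics.Sahi2008
open scoped ENNReal unitInterval

section SetBool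

variable {ι : Type*}

open Classical in
/-- **Sets as Boolean sequences**: the order isomorphism `Set ι ≃o (ι → Bool)`, `x ↦ (i ∈ x)_i`. -/
def setBoolIso : Set ι ≃o (ι → Bool) where
  toFun x := fun i => decide (i ∈ x)
  invFun u := {i | u i = true}
  left_inv x := by ext i; simp
  right_inv u := by funext i; simp
  map_rel_iff' {x y} := by
    constructor
    · intro h i hi
      have := h i
      simp only [Equiv.coe_fn_mk, hi, decide_true, Bool.le_iff_imp, forall_const, decide_eq_true_eq] at this
      exact this
    · intro h i
      simp only [Equiv.coe_fn_mk, Bool.le_iff_imp, decide_eq_true_eq]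
      exact fun hi => h hi

/-- `setBoolIso x i = true ↔ i ∈ x`. [folklore] -/
@[simp] theorem setBoolIso_apply_eq_true (x : Set ι) (i : ι) : setBoolIso x i = true ↔ i ∈ x := by
  classical
  change decide (i ∈ x) = true ↔ i ∈ x
  exact decide_eq_true_iff

/-- `setBoolIso.symm u = {i | u i}`. [folklore] -/
theorem setBoolIso_symm_apply (u : ι → Bool) : (setBoolIso (ι := ι)).symm u = {i | u i = true} := rfl

/-- The indicator map is measurable. [folklore] -/
theorem measurable_setBoolIso : Measurable (setBoolIso (ι := ι)) := by
  refine measurable_pi_lambda _ fun i => measurable_to_countable' fun b => ?_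
  have h : (fun x : Set ι => setBoolIso x i) ⁻¹' {b} = if b then {x | i ∈ x} else {x | i ∉ x} := by
    ext x
    cases b
    · simp only [mem_preimage, mem_singleton_iff, Bool.false_eq_true, ↓reduceIte, mem_setOf_eq]
      rw [← setBoolIso_apply_eq_true, Bool.not_eq_true]
    · simp only [mem_preimage, mem_singleton_iff, ↓reduceIte, mem_setOf_eq, setBoolIso_apply_eq_true]
  rw [h]
  split_ifs
  · exact measurableSet_mem i
  · exact measurableSet_notMem i

/-- The support map is measurable. [folklore] -/
theorem measurable_setBoolIso_symm : Measurable (setBoolIso (ι := ι)).symm :=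
  measurable_set_iff.2 fun i => (Measurable.of_discrete (α := Bool) (f := fun b : Bool => b = true)).comp
    (measurable_pi_apply i)

/-- The indicator map is a measurable embedding. [folklore] -/
theorem measurableEmbedding_setBoolIso : MeasurableEmbedding (setBoolIso (ι := ι)) :=
  (show Set ι ≃ᵐ (ι → Bool) from
    { toEquiv := (setBoolIso (ι := ι)).toEquiv
      measurable_toFun := measurable_setBoolIso
      measurable_invFun := measurable_setBoolIso_symm }).measurableEmbedding

/-- The support map is a measurable embedding. [folklore] -/
theorem measurableEmbedding_setBoolIso_symm : MeasurableEmbedding (setBoolIso (ι := ι)).symm :=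
  (show (ι → Bool) ≃ᵐ Set ι from
    { toEquiv := (setBoolIso (ι := ι)).symm.toEquiv
      measurable_toFun := measurable_setBoolIso_symm
      measurable_invFun := measurable_setBoolIso }).measurableEmbedding

/-- **Box-TP₂ on `Set ι` ⟺ box-TP₂ of the image law on `{0,1}^ι`.** [folklore] -/
theorem isBoxTP2_iff_map_setBoolIso (μ : Measure (Set ι)) : IsBoxTP2 (μ.map setBoolIso) ↔ IsBoxTP2 μ := by
  constructor
  · intro h
    have h2 := h.map_orderIso (setBoolIso (ι := ι)).symm measurableEmbedding_setBoolIso_symm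
    rwa [Measure.map_map measurable_setBoolIso_symm measurable_setBoolIso,
      show ((setBoolIso (ι := ι)).symm : (ι → Bool) → Set ι) ∘ setBoolIso = id from
        funext fun x => (setBoolIso (ι := ι)).symm_apply_apply x, Measure.map_id] at h2
  · intro h
    exact h.map_orderIso setBoolIso measurableEmbedding_setBoolIso

/-- The support map is measure preserving from the image law back to `μ`. [folklore] -/
theorem measurePreserving_setBoolIso_symm (μ : Measure (Set ι)) :
    MeasurePreserving (setBoolIso (ι := ι)).symm (μ.map setBoolIso) μ := by
  refine ⟨measurable_setBoolIso_symm, ?_⟩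
  rw [Measure.map_map measurable_setBoolIso_symm measurable_setBoolIso,
    show ((setBoolIso (ι := ι)).symm : (ι → Bool) → Set ι) ∘ setBoolIso = id from
      funext fun x => (setBoolIso (ι := ι)).symm_apply_apply x, Measure.map_id]

/-- **Set cylinders are Boolean cylinders**: `{x | x ∩ J = A ∩ J}` is the preimage, under the indicator map, of the
cylinder `{u | u|_J = 1_A|_J}`. [folklore] -/
theorem setCylinder_eq_preimage (J : Finset ι) (A : Set ι) :
    {x : Set ι | x ∩ ↑J = A ∩ ↑J} = setBoolIso ⁻¹' {u : ι → Bool | J.restrict u = J.restrict (setBoolIso A)} := by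
  ext x
  simp only [mem_preimage, mem_setOf_eq]
  constructor
  · intro h
    funext j
    have hj : (j : ι) ∈ x ∩ ↑J ↔ (j : ι) ∈ A ∩ ↑J := by rw [h]
    simp only [mem_inter_iff, Finset.mem_coe, j.2, and_true] at hj
    simp only [Finset.restrict_def]
    rw [Bool.eq_iff_iff, setBoolIso_apply_eq_true, setBoolIso_apply_eq_true]
    exact hj
  · intro h
    ext i
    simp only [mem_inter_iff, Finset.mem_coe]
    constructor
    · rintro ⟨hi, hiJ⟩
      have := congr_fun h ⟨i, hiJ⟩
      simp only [Finset.restrict_def] at this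
      rw [Bool.eq_iff_iff, setBoolIso_apply_eq_true, setBoolIso_apply_eq_true] at this
      exact ⟨this.1 hi, hiJ⟩
    · rintro ⟨hi, hiJ⟩
      have := congr_fun h ⟨i, hiJ⟩
      simp only [Finset.restrict_def] at this
      rw [Bool.eq_iff_iff, setBoolIso_apply_eq_true, setBoolIso_apply_eq_true] at this
      exact ⟨this.2 hi, hiJ⟩

/-- Every Boolean pattern on `J` is the restriction of the indicator of a set. [folklore] -/
theorem exists_restrict_setBoolIso_eq (J : Finset ι) (x : ↥J → Bool) :
    J.restrict (setBoolIso {i : ι | ∃ h : i ∈ J, x ⟨i, h⟩ = true}) = x := by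
  funext j
  simp only [Finset.restrict_def]
  rw [Bool.eq_iff_iff, setBoolIso_apply_eq_true, mem_setOf_eq]
  constructor
  · rintro ⟨h, hx⟩
    rwa [show (⟨(j : ι), h⟩ : ↥J) = j from Subtype.ext rfl] at hx
  · intro hx
    exact ⟨j.2, by rwa [show (⟨(j : ι), j.2⟩ : ↥J) = j from Subtype.ext rfl]⟩

/-- Boolean cylinders are measurable. [folklore] -/
theorem measurableSet_boolCylinder (J : Finset ι) (x : ↥J → Bool) :
    MeasurableSet {u : ι → Bool | J.restrict u = x} :=
  (measurableSet_singleton _).preimage (Finset.measurable_restrict J)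

/-- Set cylinders are measurable. [folklore] -/
theorem measurableSet_setCylinder (J : Finset ι) (A : Set ι) : MeasurableSet {x : Set ι | x ∩ ↑J = A ∩ ↑J} := by
  rw [setCylinder_eq_preimage]
  exact (measurableSet_boolCylinder J _).preimage measurable_setBoolIso

/-- Indicators turn `∩`/`∪` into `⊓`/`⊔` of patterns. [folklore] -/
theorem restrict_setBoolIso_inter (J : Finset ι) (A B : Set ι) :
    J.restrict (setBoolIso (A ∩ B)) = J.restrict (setBoolIso A) ⊓ J.restrict (setBoolIso B) := by
  funext j
  simp only [Finset.restrict_def, Pi.inf_apply]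
  rw [Bool.eq_iff_iff, setBoolIso_apply_eq_true, mem_inter_iff]
  simp only [Bool.min_eq_and, Bool.and_eq_true, setBoolIso_apply_eq_true]

/-- Indicators turn `∩`/`∪` into `⊓`/`⊔` of patterns. [folklore] -/
theorem restrict_setBoolIso_union (J : Finset ι) (A B : Set ι) :
    J.restrict (setBoolIso (A ∪ B)) = J.restrict (setBoolIso A) ⊔ J.restrict (setBoolIso B) := by
  funext j
  simp only [Finset.restrict_def, Pi.sup_apply]
  rw [Bool.eq_iff_iff, setBoolIso_apply_eq_true, mem_union]
  simp only [Bool.max_eq_or, Bool.or_eq_true, setBoolIso_apply_eq_true]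

/-- **FKG-lattice cylinder probabilities for a random set ⇒ box-TP₂.** [this work] -/
theorem isBoxTP2_of_fkg_setCylinders (e : ι ≃ ℕ) (μ : Measure (Set ι)) [IsFiniteMeasure μ]
    (hfkg : ∀ (J : Finset ι) (A B : Set ι),
      μ.real {x | x ∩ ↑J = A ∩ ↑J} * μ.real {x | x ∩ ↑J = B ∩ ↑J} ≤
        μ.real {x | x ∩ ↑J = (A ∩ B) ∩ ↑J} * μ.real {x | x ∩ ↑J = (A ∪ B) ∩ ↑J}) : IsBoxTP2 μ := by
  rw [← isBoxTP2_iff_map_setBoolIso]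
  haveI : IsFiniteMeasure (μ.map (setBoolIso (ι := ι))) := Measure.isFiniteMeasure_map μ _
  refine isBoxTP2_of_fkg_cylinders e _ fun J x y => ?_
  -- realise the patterns as indicators of sets
  set A : Set ι := {i | ∃ h : i ∈ J, x ⟨i, h⟩ = true} with hA
  set B : Set ι := {i | ∃ h : i ∈ J, y ⟨i, h⟩ = true} with hB
  have hxA : x = J.restrict (setBoolIso A) := (exists_restrict_setBoolIso_eq J x).symm
  have hyB : y = J.restrict (setBoolIso B) := (exists_restrict_setBoolIso_eq J y).symm
  have hre : ∀ C : Set ι, (μ.map (setBoolIso (ι := ι))).real {u | J.restrict u = J.restrict (setBoolIso C)} =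
      μ.real {x | x ∩ ↑J = C ∩ ↑J} := fun C => by
    rw [measureReal_def, Measure.map_apply measurable_setBoolIso (measurableSet_boolCylinder J _),
      ← setCylinder_eq_preimage, ← measureReal_def]
  rw [hxA, hyB, ← restrict_setBoolIso_inter, ← restrict_setBoolIso_union, hre, hre, hre, hre]
  exact hfkg J A B

variable {n : ℕ}

/-- **`(∀ d, LiebSahiContinuum d n)` ⟹ every box-TP₂ probability measure on `Set ι` (`ι ≃ ℕ`) is Sahi-positive of
order `n`** for all measurable nonnegative functionals monotone for `⊆`. [this work] -/
theorem msahiE_nonneg_of_isBoxTP2_set (e : ι ≃ ℕ) (hL : ∀ d, LiebSahiContinuum d n) (μ : Measure (Set ι))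
    [IsProbabilityMeasure μ] (hμ : IsBoxTP2 μ) (f : Fin n → Set ι → ℝ) (hfm : ∀ i, Measurable (f i))
    (hf0 : ∀ i x, 0 ≤ f i x) (hmono : ∀ i, Monotone (f i)) : 0 ≤ msahiE μ n f := by
  haveI : IsProbabilityMeasure (μ.map (setBoolIso (ι := ι))) :=
    Measure.isProbabilityMeasure_map measurable_setBoolIso.aemeasurable
  rw [← msahiE_comp_measurePreserving (measurePreserving_setBoolIso_symm μ) measurableEmbedding_setBoolIso_symm n f]
  exact msahiE_nonneg_of_isBoxTP2_spins_countable e hL _ ((isBoxTP2_iff_map_setBoolIso μ).2 hμ) _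
    (fun i => (hfm i).comp measurable_setBoolIso_symm) (fun i u => hf0 i _)
    fun i u v huv => hmono i ((setBoolIso (ι := ι)).symm.monotone huv)

/-- Decreasing functionals (monotone for `⊇`). [this work] -/
theorem msahiE_nonneg_of_isBoxTP2_set_antitone (e : ι ≃ ℕ) (hL : ∀ d, LiebSahiContinuum d n) (μ : Measure (Set ι))
    [IsProbabilityMeasure μ] (hμ : IsBoxTP2 μ) (f : Fin n → Set ι → ℝ) (hfm : ∀ i, Measurable (f i))
    (hf0 : ∀ i x, 0 ≤ f i x) (hanti : ∀ i, Antitone (f i)) : 0 ≤ msahiE μ n f := by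
  haveI : IsProbabilityMeasure (μ.map (setBoolIso (ι := ι))) :=
    Measure.isProbabilityMeasure_map measurable_setBoolIso.aemeasurable
  rw [← msahiE_comp_measurePreserving (measurePreserving_setBoolIso_symm μ) measurableEmbedding_setBoolIso_symm n f]
  exact msahiE_nonneg_of_isBoxTP2_spins_countable_antitone e hL _ ((isBoxTP2_iff_map_setBoolIso μ).2 hμ) _
    (fun i => (hfm i).comp measurable_setBoolIso_symm) (fun i u => hf0 i _)
    fun i u v huv => hanti i ((setBoolIso (ι := ι)).symm.monotone huv)

/-- **Random subsets with FKG-lattice cylinder probabilities: `C_n` ⟹ Sahi positivity of order `n`.** [this work] -/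
theorem msahiE_nonneg_of_fkg_setCylinders (e : ι ≃ ℕ) (hL : ∀ d, LiebSahiContinuum d n) (μ : Measure (Set ι))
    [IsProbabilityMeasure μ]
    (hfkg : ∀ (J : Finset ι) (A B : Set ι),
      μ.real {x | x ∩ ↑J = A ∩ ↑J} * μ.real {x | x ∩ ↑J = B ∩ ↑J} ≤
        μ.real {x | x ∩ ↑J = (A ∩ B) ∩ ↑J} * μ.real {x | x ∩ ↑J = (A ∪ B) ∩ ↑J})
    (f : Fin n → Set ι → ℝ) (hfm : ∀ i, Measurable (f i)) (hf0 : ∀ i x, 0 ≤ f i x) (hmono : ∀ i, Monotone (f i)) :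
    0 ≤ msahiE μ n f :=
  msahiE_nonneg_of_isBoxTP2_set e hL μ (isBoxTP2_of_fkg_setCylinders e μ hfkg) f hfm hf0 hmono

/-- The same from `C_n`. [this work; cite: Sahi2008, Conj. 5 (p. 212); LiebSahi2021, Conj. 1.1] -/
theorem msahiE_nonneg_of_fkg_setCylinders_of_sahiConjecture (e : ι ≃ ℕ) (hC : SahiConjecture n)
    (μ : Measure (Set ι)) [IsProbabilityMeasure μ]
    (hfkg : ∀ (J : Finset ι) (A B : Set ι),
      μ.real {x | x ∩ ↑J = A ∩ ↑J} * μ.real {x | x ∩ ↑J = B ∩ ↑J} ≤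
        μ.real {x | x ∩ ↑J = (A ∩ B) ∩ ↑J} * μ.real {x | x ∩ ↑J = (A ∪ B) ∩ ↑J})
    (f : Fin n → Set ι → ℝ) (hfm : ∀ i, Measurable (f i)) (hf0 : ∀ i x, 0 ≤ f i x) (hmono : ∀ i, Monotone (f i)) :
    0 ≤ msahiE μ n f :=
  msahiE_nonneg_of_fkg_setCylinders e ((sahiConjecture_iff_forall_liebSahiContinuum n).1 hC) μ hfkg f hfm hf0 hmono

/-- **Unconditionally: the FKG inequality for random subsets of a countable set with FKG-lattice cylinder
probabilities**, for all measurable nonnegative `⊆`-monotone functionals. [this work] -/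
theorem integral_mul_integral_le_of_fkg_setCylinders (e : ι ≃ ℕ) (μ : Measure (Set ι)) [IsProbabilityMeasure μ]
    (hfkg : ∀ (J : Finset ι) (A B : Set ι),
      μ.real {x | x ∩ ↑J = A ∩ ↑J} * μ.real {x | x ∩ ↑J = B ∩ ↑J} ≤
        μ.real {x | x ∩ ↑J = (A ∩ B) ∩ ↑J} * μ.real {x | x ∩ ↑J = (A ∪ B) ∩ ↑J})
    {f g : Set ι → ℝ} (hfm : Measurable f) (hgm : Measurable g) (hf0 : ∀ x, 0 ≤ f x) (hg0 : ∀ x, 0 ≤ g x)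
    (hf : Monotone f) (hg : Monotone g) : (∫ x, f x ∂μ) * (∫ x, g x ∂μ) ≤ ∫ x, f x * g x ∂μ := by
  have h := msahiE_nonneg_of_fkg_setCylinders e (fun d => liebSahiContinuum_of_order_le_two d le_rfl) μ hfkg ![f, g]
    (fun i => by fin_cases i <;> assumption) (fun i => by fin_cases i <;> assumption)
    (fun i => by fin_cases i <;> assumption)
  rw [msahiE_two] at h
  linarith

end SetBool

end Summit.CriticalPhenomena.PercolationContinuityZ3.Theorems.SahiBoxTP2
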